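import Summits.QuantumAdvantage.AdviceFreeQNC0.TensorLPNorm
import Summits.QuantumAdvantage.AdviceFreeQNC0.UnionBoundLift
import Summits.QuantumAdvantage.AdviceFreeQNC0.DiversityRungs
import HarnessLib

/-!
# Cell qa-qnc0 (rung F-Q1, crux α `RingToElim` / density axis, crux of record `TensorMultOneAt`):
# the LP RUNG OF MULT₁ — the NORM-AGNOSTIC last-block induction in the kernel

Planner qa-qnc0-p1 gen 13 (`HOME/qa-qnc0-p1/ROUND-12.md` §2.10, `Sketch13.lean` v4, fence F12.4): cut
`{0,1}^{m(k+1)}` along the LAST block.  On the fibre over a last-block content `v`, an element of the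
`(k+1)`-block degree-`1` sum code is `W'_v ⊕ Y_v` with `W'_v` in the `k`-block sum code of the first
`mk` coordinates and `Y_v(u') = T_{|v| mod 3}(u' ++ v)` AFFINE in `v` (the last even triple), i.e.
`𝟙 + Y_v = lastPlayerVal(v)` for the singleton block structure with values in the exponent-`2` group
`Q = 𝔽₂^{{0,1}^{mk}}`, `e = 𝟙`, `c_ρ = 𝟙 + T_ρ(· ++ 0)`, `g_ρ i = T_ρ(· ++ eᵢ) + T_ρ(· ++ 0)`.  With the
COSET-LEADER WEIGHT `cnorm f = min_{w ∈ S_k} #{u' : f u' ≠ w u'}` (subadditive, nonnegative) one gets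
`#FAIL = Σ_v #FAIL(fibre v) ≥ Σ_v cnorm(lastPlayerVal v) ≥ V · cnorm 𝟙 = V · min_{S_k} #FAIL ≥ V^{k+1}`
whenever the last player PAYS `V` in every normed exponent-`2` group (`DiversityPays m m singletons V`,
Sketch13 v4).  Hence

* **`tensorMultAt_one_of_diversityPays`**:
  `0 ≤ V → DiversityPays m m (fun j => {j}) V → TensorMultAt m 1 (V / 2^m)`.

This is the "≤ LP" direction of F12.4 as a theorem: every norm-agnostic (packing / LP) certificate of
the one-block step tensorises to ALL `k`.  The LP certificates themselves (`τ*(C_m) = 1, 2, 8, 16, 256/7`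
for `m = 4, …, 8`) are kernel-checked in `TensorLPCertificates.lean`; the generic certificate checker
is `DiversityCertificates.lean`; the coset-leader weight `cnorm` is `TensorLPNorm.lean`.

The defs `blockPar`, `lastPlayerVal`, `DiversityPays` (Sketch13 v4 verbatim) are imported from
`DiversityRungs.lean` (qa-qnc0-prover-2).  The cell's theorems (not in print).

WHAT THIS IS NOT: no bearing on MULT₁ proper (`TensorMultOneAt` needs `β > 1/4`; the LP gives at most
`τ*(C_m)/2^m ≤ 1/7`, ROUND-12 §2.7(a)); nothing on α; separation NOT moved.
-/

noncomputable section

namespace Summit.QuantumAdvantage.AdviceFreeQNC0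

open Finset
open Literature.Computability.MetaComplexity Literature.Computability.MetaComplexity.Smolensky

namespace TensorLP

/-! ### Geometry of the last block: `{0,1}^{mk+m} = {0,1}^{mk} × {0,1}^m` -/

section LastBlock

variable {m k : ℕ}

/-- On the leading `mk` coordinates the block index of the `(k+1)`-block split is `⌊i/m⌋`. -/
theorem blockIdx_castAdd (i : Fin (m * k)) :
    blockIdx (m * k + m) (k + 1) (Fin.castAdd m i) = i.val / m :=
  TensorBlocksFixed.blockIdx_mul (m := m) (k := k + 1) (Nat.succ_pos k) (Fin.castAdd m i)

/-- On the leading coordinates the block index is `< k`. -/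
theorem div_lt_of_fin (i : Fin (m * k)) : i.val / m < k := by
  rcases Nat.eq_zero_or_pos m with hm | hm
  · subst hm; exact absurd i.isLt (by simp)
  · exact (Nat.div_lt_iff_lt_mul hm).2 (i.isLt.trans_eq (Nat.mul_comm m k))

/-- A leading coordinate exists only if `0 < k`. -/
theorem pos_of_fin (i : Fin (m * k)) : 0 < k :=
  lt_of_le_of_lt (Nat.zero_le _) (div_lt_of_fin i)

/-- The last `m` coordinates form block `k`. -/
theorem blockIdx_natAdd (j : Fin m) : blockIdx (m * k + m) (k + 1) (Fin.natAdd (m * k) j) = k := by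
  have h : blockIdx (m * k + m) (k + 1) (Fin.natAdd (m * k) j) = (Fin.natAdd (m * k) j).val / m :=
    TensorBlocksFixed.blockIdx_mul (m := m) (k := k + 1) (Nat.succ_pos k) (Fin.natAdd (m * k) j)
  rw [h]
  have hm : 0 < m := Nat.pos_of_ne_zero fun h => by subst h; exact absurd j.isLt (by simp)
  show (m * k + j.val) / m = k
  rw [Nat.mul_add_div hm, Nat.div_eq_of_lt j.isLt, add_zero]

/-- The leading blocks agree with the `k`-block split of `{0,1}^{mk}`. -/
theorem blockIdx_castAdd' (i : Fin (m * k)) :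
    blockIdx (m * k + m) (k + 1) (Fin.castAdd m i) = blockIdx (m * k) k i := by
  rw [blockIdx_castAdd, TensorBlocksFixed.blockIdx_mul (pos_of_fin i)]

/-- Merging a leading block commutes with appending the last block. -/
theorem append_mergeBlock {j : ℕ} (hj : j < k) (v' w : Fin (m * k) → Bool)
    (z : Fin m → Bool) :
    Fin.append (mergeBlock (m * k) k j v' w) z =
      mergeBlock (m * k + m) (k + 1) j (Fin.append v' z) (Fin.append w z) := by
  funext x
  induction x using Fin.addCases with
  | left i =>
    simp only [mergeBlock, Fin.append_left, blockIdx_castAdd']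
  | right i =>
    simp only [mergeBlock, Fin.append_right, blockIdx_natAdd]
    rw [if_neg (Nat.ne_of_gt hj)]

/-- The weight of a leading block is read off the leading part. -/
theorem blockWt_append_lt {j : ℕ} (hj : j < k) (u : Fin (m * k) → Bool)
    (z : Fin m → Bool) :
    blockWt (m * k + m) (k + 1) j (Fin.append u z) = blockWt (m * k) k j u := by
  unfold blockWt
  have hset : (univ.filter fun x : Fin (m * k + m) =>
        blockIdx (m * k + m) (k + 1) x = j ∧ Fin.append u z x = true) =
      (univ.filter fun i : Fin (m * k) => blockIdx (m * k) k i = j ∧ u i = true).map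
        (Fin.castAddEmb m) := by
    ext x
    simp only [mem_filter, mem_univ, true_and, mem_map]
    constructor
    · rintro ⟨hx, hux⟩
      induction x using Fin.addCases with
      | left i =>
        refine ⟨i, ⟨?_, ?_⟩, rfl⟩
        · rwa [blockIdx_castAdd'] at hx
        · rwa [Fin.append_left] at hux
      | right i =>
        rw [blockIdx_natAdd] at hx
        exact absurd hx (Nat.ne_of_gt hj)
    · rintro ⟨i, ⟨hi, hui⟩, rfl⟩
      refine ⟨?_, ?_⟩
      · show blockIdx (m * k + m) (k + 1) (Fin.castAdd m i) = j
        rw [blockIdx_castAdd']; exact hi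
      · show Fin.append u z (Fin.castAdd m i) = true
        rw [Fin.append_left]; exact hui
  rw [hset, card_map]

/-- Merging the LAST block: leading part from the first argument, last block from the second. -/
theorem mergeBlock_last (u' U : Fin (m * k) → Bool) (v₀ v : Fin m → Bool) :
    mergeBlock (m * k + m) (k + 1) k (Fin.append u' v₀) (Fin.append U v) = Fin.append u' v := by
  funext x
  induction x using Fin.addCases with
  | left i =>
    simp only [mergeBlock, Fin.append_left, blockIdx_castAdd]
    rw [if_neg (Nat.ne_of_lt (div_lt_of_fin i))]
  | right i =>
    simp only [mergeBlock, Fin.append_right, blockIdx_natAdd, if_true]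

/-- The weight of the last block is the weight of the appended content. -/
theorem blockWt_append_last (u' : Fin (m * k) → Bool) (v : Fin m → Bool) :
    blockWt (m * k + m) (k + 1) k (Fin.append u' v) = (univ.filter fun i : Fin m => v i = true).card := by
  unfold blockWt
  have hset : (univ.filter fun x : Fin (m * k + m) =>
        blockIdx (m * k + m) (k + 1) x = k ∧ Fin.append u' v x = true) =
      (univ.filter fun i : Fin m => v i = true).map (Fin.natAddEmb (m * k)) := by
    ext x
    simp only [mem_filter, mem_univ, true_and, mem_map]
    constructor
    · rintro ⟨hx, hux⟩
      induction x using Fin.addCases with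
      | left i =>
        rw [blockIdx_castAdd] at hx
        exact absurd hx (Nat.ne_of_lt (div_lt_of_fin i))
      | right i =>
        refine ⟨i, ?_, rfl⟩
        rwa [Fin.append_right] at hux
    · rintro ⟨i, hi, rfl⟩
      refine ⟨?_, ?_⟩
      · show blockIdx (m * k + m) (k + 1) (Fin.natAdd (m * k) i) = k
        exact blockIdx_natAdd i
      · show Fin.append u' v (Fin.natAdd (m * k) i) = true
        rw [Fin.append_right]; exact hi
  rw [hset, card_map]

/-- Restriction of a low-degree Boolean function along `Fin.append u' ·` (fixing the LEADING
coordinates) keeps the degree (substitution lemma). -/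
theorem hasDeg_append_left {D : ℕ} {f : (Fin (m * k + m) → Bool) → Bool} (hf : HasDeg f D)
    (u' : Fin (m * k) → Bool) : HasDeg (fun v : Fin m → Bool => f (Fin.append u' v)) D := by
  refine comp_subst_mem_lowDeg (fun v : Fin m → Bool => Fin.append u' v) (fun x => ?_) hf
  induction x using Fin.addCases with
  | left i => exact Or.inl ⟨u' i, fun v => by rw [Fin.append_left]⟩
  | right i => exact Or.inr ⟨i, fun v => by rw [Fin.append_right]⟩

/-- Slicing a leading-block even triple along the last block gives an even triple of the
`k`-block split of `{0,1}^{mk}`. -/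
theorem isBlockElim_slice {j : ℕ} (hj : j < k) {X : (Fin (m * k + m) → Bool) → Bool}
    (hX : IsBlockElim (m * k + m) (k + 1) j 1 X) (v : Fin m → Bool) :
    IsBlockElim (m * k) k j 1 (fun u' => X (Fin.append u' v)) := by
  obtain ⟨T, hTdeg, hTe, hTX⟩ := hX
  refine ⟨fun r u' => T r (Fin.append u' v), fun r v' => ?_, fun u' => hTe _, fun u' => ?_⟩
  · have heq : (fun w : Fin (m * k) → Bool => T r (Fin.append (mergeBlock (m * k) k j v' w) v)) =
        fun w => (fun W => T r (mergeBlock (m * k + m) (k + 1) j (Fin.append v' v) W))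
          (Fin.append w v) := by
      funext w; rw [append_mergeBlock hj]
    show HasDeg (fun w : Fin (m * k) → Bool => T r (Fin.append (mergeBlock (m * k) k j v' w) v)) 1
    rw [heq]
    exact TensorBlocksFixed.hasDeg_append (hTdeg r (Fin.append v' v)) v
  · show X (Fin.append u' v) = T (blockWt (m * k) k j u' % 3) (Fin.append u' v)
    rw [hTX, blockWt_append_lt hj]

/-- `blockPar {j} v = v j`. -/
theorem blockPar_singleton (j : Fin m) (v : Fin m → Bool) : blockPar ({j} : Finset (Fin m)) v = v j := by
  unfold blockPar
  rw [filter_singleton]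
  cases v j <;> simp

end LastBlock

/-! ### The induction step -/

/-- **The last-block step**: if the last player pays `V` in every normed exponent-2 group and every
element of the `k`-block sum-code coset of `𝟙` fails on `≥ V^k` inputs, then every element of the
`(k+1)`-block coset fails on `≥ V^{k+1}` inputs. -/
theorem step {m k : ℕ} {V : ℝ} (hV0 : 0 ≤ V)
    (hV : DiversityPays m m (fun j => ({j} : Finset (Fin m))) V)
    (IH : ∀ w : (Fin (m * k) → Bool) → Bool, SumCodeWin (m * k) k 1 w → V ^ k ≤ (failCount w : ℝ))
    (win : (Fin (m * k + m) → Bool) → Bool) (hwin : SumCodeWin (m * k + m) (k + 1) 1 win) :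
    V ^ (k + 1) ≤ (failCount win : ℝ) := by
  obtain ⟨X, hX, hwinX⟩ := hwin
  obtain ⟨T, hTdeg, hTeven, hTX⟩ := hX k (Nat.lt_succ_self k)
  -- the affine coefficients of the last triple in the last block's bits
  set A : ℕ → CubeFn (ZMod 2) (m * k) := fun r u' => ι (T r (Fin.append u' fun _ => false)) with hA
  set B : ℕ → Fin m → CubeFn (ZMod 2) (m * k) := fun r i u' =>
    ι (T r (Fin.append u' (basisRow i))) + ι (T r (Fin.append u' fun _ => false)) with hB
  have haff : ∀ (r : ℕ) (u' : Fin (m * k) → Bool) (v : Fin m → Bool),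
      ι (T r (Fin.append u' v)) = A r u' + ∑ i, (if v i = true then B r i u' else 0) := by
    intro r u' v
    have hg : (fun v : Fin m → Bool => ι (T r (Fin.append u' v))) ∈ lowDeg (ZMod 2) m 1 := by
      have h2 := hasDeg_append_left (hTdeg r (Fin.append u' v)) u'
      have heq : (fun v' : Fin m → Bool =>
          T r (mergeBlock (m * k + m) (k + 1) k (Fin.append u' v) (Fin.append u' v'))) =
          fun v' => T r (Fin.append u' v') := funext fun v' => by rw [mergeBlock_last]
      unfold HasDeg at h2
      rw [heq] at h2
      exact h2
    have key := eq_affine_of_mem_lowDeg_one hg v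
    simp only at key
    rw [key]
    simp only [hA, hB]
    congr 1
    refine sum_congr rfl fun i _ => ?_
    split_ifs <;> simp
  have hT3 : ∀ x, ι (T 0 x) + ι (T 1 x) + ι (T 2 x) = 0 := fun x => by
    rw [ι_add3, hTeven, ι_false]
  have hAeven : ∀ u', A 2 u' = A 0 u' + A 1 u' := fun u' => by
    apply eq_add_of_sum3
    simp only [hA]
    exact hT3 _
  have hBeven : ∀ i u', B 2 i u' = B 0 i u' + B 1 i u' := fun i u' => by
    apply eq_add_of_sum3
    have h1 := hT3 (Fin.append u' (basisRow i))
    have h2 := hT3 (Fin.append u' fun _ => false)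
    simp only [hB]
    calc _ = (ι (T 0 (Fin.append u' (basisRow i))) + ι (T 1 (Fin.append u' (basisRow i))) +
          ι (T 2 (Fin.append u' (basisRow i)))) + (ι (T 0 (Fin.append u' fun _ => false)) +
          ι (T 1 (Fin.append u' fun _ => false)) + ι (T 2 (Fin.append u' fun _ => false))) := by ring
      _ = 0 := by rw [h1, h2, add_zero]
  -- the normed exponent-2 group `(𝔽₂^{{0,1}^{mk}}, cnorm)`
  have hsub : ∀ a b : CubeFn (ZMod 2) (m * k),
      (cnorm m k (a + b) : ℝ) ≤ (cnorm m k a : ℝ) + (cnorm m k b : ℝ) := fun a b => by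
    exact_mod_cast cnorm_add_le m k a b
  have hnn : ∀ a : CubeFn (ZMod 2) (m * k), (0 : ℝ) ≤ (cnorm m k a : ℝ) := fun a => Nat.cast_nonneg _
  have hz : ∀ y : ZMod 2, y + y = 0 := by decide
  have h2 : ∀ x : CubeFn (ZMod 2) (m * k), x + x = 0 := fun x => funext fun u => hz _
  have hDP := hV (CubeFn (ZMod 2) (m * k)) (fun f => (cnorm m k f : ℝ)) hsub hnn h2
    (1 + A 0) (1 + A 1) 1 (B 0) (B 1)
  -- the last player's values are the fibre functions `𝟙 + X_k(· ++ v)`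
  have hval : ∀ v : Fin m → Bool,
      lastPlayerVal (fun j => ({j} : Finset (Fin m))) (1 + A 0) (1 + A 1) (1 : CubeFn (ZMod 2) (m * k))
        (B 0) (B 1) v = fun u' => 1 + ι (X k (Fin.append u' v)) := by
    intro v
    funext u'
    have hρ : X k (Fin.append u' v) =
        T ((univ.filter fun i : Fin m => v i = true).card % 3) (Fin.append u' v) := by
      rw [hTX, blockWt_append_last]
    rw [hρ]
    simp only [lastPlayerVal, blockPar_singleton]
    have hlin : ∀ r, (∑ j : Fin m, (if v j = true then B r j else 0)) u' =
        ∑ j : Fin m, (if v j = true then B r j u' else 0) := fun r => by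
      rw [Finset.sum_apply]
      exact sum_congr rfl fun j _ => by split_ifs <;> rfl
    have h3 : (univ.filter fun i : Fin m => v i = true).card % 3 < 3 := Nat.mod_lt _ (by norm_num)
    rcases (by omega : (univ.filter fun i : Fin m => v i = true).card % 3 = 0 ∨
        (univ.filter fun i : Fin m => v i = true).card % 3 = 1 ∨
        (univ.filter fun i : Fin m => v i = true).card % 3 = 2) with h0 | h1 | h2'
    · rw [if_pos h0, h0, Pi.add_apply, Pi.add_apply, Pi.one_apply, hlin, haff, add_assoc]
    · rw [if_neg (by omega), if_pos h1, h1, Pi.add_apply, Pi.add_apply, Pi.one_apply, hlin, haff,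
        add_assoc]
    · rw [if_neg (by omega), if_neg (by omega), h2']
      simp only [Pi.add_apply, Pi.one_apply]
      rw [hlin, hlin, haff, hAeven]
      have hs : ∑ i : Fin m, (if v i = true then B 2 i u' else 0) =
          ∑ i : Fin m, (if v i = true then B 0 i u' else 0) +
            ∑ i : Fin m, (if v i = true then B 1 i u' else 0) := by
        rw [← sum_add_distrib]
        exact sum_congr rfl fun i _ => by split_ifs <;> simp [hBeven]
      rw [hs]
      have h11 : (1 : ZMod 2) + 1 = 0 := by decide
      linear_combination h11
  -- fibrewise: failures on the fibre over `v` dominate the coset-leader weight of the fibre function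
  have hslice : ∀ v : Fin m → Bool,
      (cnorm m k (fun u' => 1 + ι (X k (Fin.append u' v))) : ℝ) ≤
        (failCount (fun u' : Fin (m * k) → Bool => win (Fin.append u' v)) : ℝ) := by
    intro v
    have hW : SumCodeWin (m * k) k 1
        (fun u' => decide ((((range k).filter fun j => X j (Fin.append u' v) = true)).card % 2 = 1)) :=
      ⟨fun j u' => X j (Fin.append u' v),
        fun j hj => isBlockElim_slice hj (hX j (hj.trans (Nat.lt_succ_self k))) v, fun u' => rfl⟩
    have hle := cnorm_le m k (f := fun u' => 1 + ι (X k (Fin.append u' v))) hW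
    have heq : ndis (fun u' => 1 + ι (X k (Fin.append u' v)))
        (fun u' => decide ((((range k).filter fun j => X j (Fin.append u' v) = true)).card % 2 = 1)) =
        failCount (fun u' : Fin (m * k) → Bool => win (Fin.append u' v)) := by
      unfold ndis failCount
      congr 1; ext u'
      simp only [mem_filter, mem_univ, true_and]
      rw [hwinX, decide_range_succ, one_add_ι_ne_iff]
      generalize decide ((((range k).filter fun j => X j (Fin.append u' v) = true)).card % 2 = 1) = b
      cases b <;> cases X k (Fin.append u' v) <;> decide
    rw [heq] at hle
    exact_mod_cast hle
  -- the weight of the coset of `𝟙` is a failure count of the `k`-block code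
  have hone : V ^ k ≤ (cnorm m k 1 : ℝ) := by
    obtain ⟨w, hw, he⟩ := exists_eq_cnorm m k 1
    rw [← he, ndis_one]
    exact IH w hw
  -- assemble
  rw [TensorBlocksFixed.failCount_eq_sum_append (M := m * k) (r := m) win]
  push_cast
  calc V ^ (k + 1) = V * V ^ k := by ring
    _ ≤ V * (cnorm m k 1 : ℝ) := mul_le_mul_of_nonneg_left hone hV0
    _ ≤ ∑ v : Fin m → Bool, (cnorm m k (lastPlayerVal (fun j => ({j} : Finset (Fin m)))
          (1 + A 0) (1 + A 1) (1 : CubeFn (ZMod 2) (m * k)) (B 0) (B 1) v) : ℝ) := by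
        simpa only using hDP
    _ = ∑ v : Fin m → Bool, (cnorm m k (fun u' => 1 + ι (X k (Fin.append u' v))) : ℝ) := by
        refine sum_congr rfl fun v _ => ?_; rw [hval]
    _ ≤ ∑ v : Fin m → Bool, (failCount (fun u' : Fin (m * k) → Bool => win (Fin.append u' v)) : ℝ) :=
        sum_le_sum fun v _ => hslice v

/-- Base of the induction (`k = 0`): the cube `{0,1}^{m·0}` is a point and the empty sum code
forces `win ≡ false`, so `#FAIL = 1 = V^0`. -/
theorem base {m : ℕ} {V : ℝ} (win : (Fin (m * 0) → Bool) → Bool) (hwin : SumCodeWin (m * 0) 0 1 win) :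
    V ^ 0 ≤ (failCount win : ℝ) := by
  obtain ⟨X, -, hw⟩ := hwin
  have hall : ∀ u, win u = false := fun u => by rw [hw u]; simp
  have h1 : failCount win = 1 := by
    unfold failCount
    rw [filter_true_of_mem fun u _ => hall u, card_univ, Fintype.card_fun, Fintype.card_bool,
      Fintype.card_fin]
    simp
  rw [h1]; simp

end TensorLP

open TensorLP

/-- **Every `k`**: if the full-diversity last player pays `V ≥ 0` in every normed exponent-2 group,
every element of the coset of `𝟙` modulo the `k`-block degree-`1` sum code on `{0,1}^{mk}` fails on at
least `V^k` inputs. -/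
theorem pow_le_failCount_of_diversityPays {m : ℕ} {V : ℝ} (hV0 : 0 ≤ V)
    (hV : DiversityPays m m (fun j => ({j} : Finset (Fin m))) V) :
    ∀ (k : ℕ) (win : (Fin (m * k) → Bool) → Bool), SumCodeWin (m * k) k 1 win →
      V ^ k ≤ (failCount win : ℝ)
  | 0 => fun win hwin => base win hwin
  | k + 1 => fun win hwin => step hV0 hV (pow_le_failCount_of_diversityPays hV0 hV k) win hwin

/-- **THE LP RUNG OF MULT₁ (norm-agnostic induction, F12.4 "≤")**: if the full-diversity last player
pays `V ≥ 0` in every normed exponent-2 group (`DiversityPays m m singletons V` — e.g. by a fractional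
packing certificate of valid odd triples, `DiversityCertificates.lean`), then tensor multiplicativity
holds at block size `m`, block degree `1`, with ratio `V/2^m`, for EVERY number of blocks:
`TensorMultAt m 1 (V/2^m)`. -/
theorem tensorMultAt_one_of_diversityPays {m : ℕ} {V : ℝ} (hV0 : 0 ≤ V)
    (hV : DiversityPays m m (fun j => ({j} : Finset (Fin m))) V) : TensorMultAt m 1 (V / 2 ^ m) := by
  intro k _ win hwin
  have h2 : (2 : ℝ) ^ m ≠ 0 := pow_ne_zero _ two_ne_zero
  rw [div_mul_cancel₀ V h2]
  exact pow_le_failCount_of_diversityPays hV0 hV k win hwin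

end Summit.QuantumAdvantage.AdviceFreeQNC0
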